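import Summits.AtomisticToContinuum.FouriersLaw.Theorems.BondHeatUncertaintyExtensiveSnapshotIrreversibilityCorrectorIntegrability
import Summits.AtomisticToContinuum.FouriersLaw.Theorems.BondHeatUncertaintyExtensiveSnapshotIrreversibilityGibbsContactCalculus
import Summits.AtomisticToContinuum.FouriersLaw.Theorems.BondHeatUncertaintyExtensiveSnapshotIrreversibilityClausiusBudget
import Summits.AtomisticToContinuum.FouriersLaw.Theorems.OddSectorIrreversibilityOddDensityIsCorrectorAbelLimit
import HarnessLib

/-!
# Crux `ExtensiveSnapshotIrreversibility` (stmt-AtomisticToContinuum-9121), line `clausius-budget-sound-window`: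
registered sub-goal `contactPairingBound` — the SOURCE–CORRECTOR PAIRING IS O(1), uniformly in `N`

For the McLennan corrector `w = ∫₀^∞ P_s g ds` of the source `g = (γ/2T²)(p_0² − p_{N−1}²)` (equilibrium kernels, both baths at
`T`): `0 ≤ ⟨g, w⟩_{L²(μ_T)} ≤ γ/(2T²)` — the stationary form of the Clausius budget (`⟨g,w⟩ = γT(‖∂_{p_0}w‖² + ‖∂_{p_{N−1}}w‖²)`
is the contact Fisher information of the linear response; physically `⟨g,w⟩ = (γ/2T²)(1 − 2G_N/γ)`), the `N`-uniform anchor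
of the sibling line momentum-fisher-maximum-principle. Route: a CORE SEQUENCE for the corrector (`pinnedChain_corrector_core`:
test functions `F_n → w`, `LF_n → -g` in `L²(μ_T)`, diagonally from the landed core property of the window response
`pinnedChain_window_core` and the `L²` limits `k_t → w`, `P_t g → 0` given by the Harris bound), then the static contact
calculus `stub_gibbsContactCalculus` on the `F_n` (`∫ F·LF ≤ 0`, `∫ F·LF + 2∫ gF ≤ γ/(2T²)` by AM–GM) and `le_of_core_limit`.
References: Cuneo–Eckmann–Hairer–Rey-Bellet, EJP 23 (2018) no. 55, Thm 2.13, §3.1; Helffer–Nier, LNM 1862 (2005),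
Prop. 5.5; J. A. McLennan, Phys. Rev. 115 (1959).
-/

noncomputable section

namespace Summit.AtomisticToContinuum.FouriersLaw.Theorems.ExtensiveSnapshotIrreversibility.ClausiusBudget

open MeasureTheory Filter Topology
open scoped ENNReal NNReal
open Literature.MathematicalPhysics.KineticTheory.HeatConduction
open ProbabilityTheory Set
open scoped ContDiff
open Literature.MathematicalPhysics.KineticTheory
open Summit.AtomisticToContinuum.FouriersLaw.Theorems.SubdiffusiveBondHeat
open Summit.AtomisticToContinuum.FouriersLaw.Theorems.OddSectorIrreversibility

variable {N : ℕ}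

/-- If `|f| ≤ K e` pointwise and `e² ∈ L¹(μ)`, then `∫ f² dμ ≤ K² ∫ e² dμ`. [folklore] -/
theorem integral_sq_le_sq_mul_of_abs_le {X : Type*} [MeasurableSpace X] {μ : Measure X} {f e : X → ℝ} {K : ℝ}
    (he : Integrable (fun x => e x ^ 2) μ) (hf : ∀ x, |f x| ≤ K * e x) :
    ∫ x, f x ^ 2 ∂μ ≤ K ^ 2 * ∫ x, e x ^ 2 ∂μ := by
  rw [← integral_const_mul]
  refine integral_mono_of_nonneg (Eventually.of_forall fun x => sq_nonneg _) (he.const_mul _)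
    (Eventually.of_forall fun x => ?_)
  calc f x ^ 2 = |f x| ^ 2 := (sq_abs _).symm
    _ ≤ (K * e x) ^ 2 := pow_le_pow_left₀ (abs_nonneg _) (hf x) 2
    _ = K ^ 2 * e x ^ 2 := by ring

/-- `∫ (a - b)² dμ ≤ 2 ∫ (a - m)² dμ + 2 ∫ (m - b)² dμ` for `a, b, m ∈ L²(μ)` (triangle inequality through a
midpoint, squared). [folklore] -/
theorem integral_sub_sq_le_of_mid {X : Type*} [MeasurableSpace X] {μ : Measure X} {a b m : X → ℝ}
    (ha : MemLp a 2 μ) (hb : MemLp b 2 μ) (hm : MemLp m 2 μ) :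
    ∫ x, (a x - b x) ^ 2 ∂μ ≤ 2 * ∫ x, (a x - m x) ^ 2 ∂μ + 2 * ∫ x, (m x - b x) ^ 2 ∂μ := by
  have h1 : Integrable (fun x => (a x - m x) ^ 2) μ := (ha.sub hm).integrable_sq
  have h2 : Integrable (fun x => (m x - b x) ^ 2) μ := (hm.sub hb).integrable_sq
  have h12 : Integrable (fun x => 2 * (a x - m x) ^ 2 + 2 * (m x - b x) ^ 2) μ :=
    (h1.const_mul 2).add (h2.const_mul 2)
  calc ∫ x, (a x - b x) ^ 2 ∂μ ≤ ∫ x, (2 * (a x - m x) ^ 2 + 2 * (m x - b x) ^ 2) ∂μ :=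
        integral_mono_of_nonneg (Eventually.of_forall fun x => sq_nonneg _) h12
          (Eventually.of_forall fun x => by
            show (a x - b x) ^ 2 ≤ 2 * (a x - m x) ^ 2 + 2 * (m x - b x) ^ 2
            nlinarith [sq_nonneg ((a x - m x) - (m x - b x))])
    _ = 2 * ∫ x, (a x - m x) ^ 2 ∂μ + 2 * ∫ x, (m x - b x) ^ 2 ∂μ := by
        rw [integral_add (h1.const_mul 2) (h2.const_mul 2), integral_const_mul, integral_const_mul]

section Core

variable {ω₂ lam β γ : ℝ} (hω : 0 < ω₂) (hl : 0 ≤ lam) (hβ : 0 < β) (hγ : 0 < γ) (hN : 0 < N)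
  {T : ℝ} (hT : 0 < T)
include hω hl hβ hγ hN hT

/-- **Core sequence for the McLennan corrector.** For the pinned chain at temperature `T` (`N ≥ 2`), a nice
continuous CENTRED source `g` (`|g| ≤ M e^{ϑH}`, `0 < ϑ`, `2ϑ < 1/T`, `μ_T(g) = 0`), `Pg s = P_{s⁺} g` and the
corrector `w = ∫_{(0,∞)} Pg s ds`: `g, w ∈ L²(μ_T)` and there are test functions `F_n → w` with `L F_n → -g` in
`L²(μ_T)` (`w` is in the domain of the `L²(μ_T)`-closure of `(L, C_c^∞)`, with image `-g`). Proof: the Harris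
bound `|Pg s(z)| ≤ K M e^{ϑH(z)} e^{-cs}` gives the tail estimate `|w - k_t| = |∫_t^∞ Pg s ds| ≤ (KM/c) e^{-ct} e^{ϑH}`
for the window response `k_t = ∫₀ᵗ Pg s ds`, so `‖k_t - w‖², ‖P_t g‖² ≤ const·e^{-2ct} ∫ e^{2ϑH} dμ_T → 0`; pick `t`
with both `≤ δ`, then (`pinnedChain_window_core`) a test function `F` with `‖F - k_t‖², ‖LF - (P_t g - g)‖² ≤ δ`,
whence `‖F - w‖², ‖LF + g‖² ≤ 4δ`. [cite: CuneoEckmannHairerReyBellet2018, Thm 2.13 and §3.1] -/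
theorem pinnedChain_corrector_core {ϑ M : ℝ} (hϑ : 0 < ϑ) (h2ϑ : 2 * ϑ < 1 / T) (hM : 0 ≤ M)
    {g : PhaseSpace N → ℝ} (hg : Continuous g)
    (hgM : ∀ y, |g y| ≤ M * Real.exp (ϑ * (pinnedChain ω₂ lam β γ).hamiltonian N y))
    (hg0 : ∫ y, g y ∂((pinnedChain ω₂ lam β γ).gibbsMeasure N T) = 0)
    (Pg : ℝ → PhaseSpace N → ℝ)
    (hPg : Pg = fun s z => ∫ y, g y ∂((pinnedChain ω₂ lam β γ).transitionKernel N T T s.toNNReal z))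
    (w : PhaseSpace N → ℝ) (hw : w = fun z => ∫ s in Set.Ioi (0 : ℝ), Pg s z) (hN2 : 2 ≤ N) :
    MemLp g 2 ((pinnedChain ω₂ lam β γ).gibbsMeasure N T) ∧
    MemLp w 2 ((pinnedChain ω₂ lam β γ).gibbsMeasure N T) ∧
    ∃ Fs : ℕ → PhaseSpace N → ℝ, (∀ n, ContDiff ℝ (⊤ : ℕ∞) (Fs n) ∧ HasCompactSupport (Fs n)) ∧
      Tendsto (fun n => ∫ z, (Fs n z - w z) ^ 2 ∂((pinnedChain ω₂ lam β γ).gibbsMeasure N T)) atTop (𝓝 0) ∧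
      Tendsto (fun n => ∫ z, ((pinnedChain ω₂ lam β γ).generator N T T (Fs n) z - (-g z)) ^ 2
        ∂((pinnedChain ω₂ lam β γ).gibbsMeasure N T)) atTop (𝓝 0) := by
  set P := pinnedChain ω₂ lam β γ with hP
  set H := P.hamiltonian N with hH
  set μ := P.gibbsMeasure N T with hμ
  haveI : IsProbabilityMeasure μ := pinnedChain_isProbabilityMeasure_gibbsMeasure hω hl hβ.le γ N hT
  -- the window response `k_t = ∫₀ᵗ Pg s ds` and its kinetics
  obtain ⟨k, hk⟩ : ∃ k : ℝ → PhaseSpace N → ℝ, k = fun τ z => ∫ s in (0 : ℝ)..τ, Pg s z := ⟨_, rfl⟩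
  obtain ⟨-, ⟨C, -, hPgb, -⟩, hSM, hkreg, -⟩ :=
    pinnedChain_act_window hω hl hβ hγ hN hT hϑ h2ϑ hM hg hgM Pg hPg k hk
  have hPg_apply : ∀ s z, Pg s z = ∫ y, g y ∂(P.transitionKernel N T T s.toNNReal z) := fun s z => by
    rw [hPg]
  have hk_apply : ∀ τ z, k τ z = ∫ s in (0 : ℝ)..τ, Pg s z := fun τ z => by rw [hk]
  have hw_apply : ∀ z, w z = ∫ s in Ioi (0 : ℝ), Pg s z := fun z => by rw [hw]
  -- the Harris bound and the decay of `P_s g`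
  obtain ⟨K, c, -, hc, hb⟩ := pinnedChain_harris_bound hω hl hβ hγ hN hT hϑ (by linarith)
  have hkubo : ∀ z : PhaseSpace N, IntegrableOn (fun s => Pg s z) (Ioi (0 : ℝ)) ∧
      ∀ t : ℝ, 0 ≤ t → |Pg t z| ≤ K * M * Real.exp (ϑ * H z) * Real.exp (-c * t) := by
    intro z
    rw [hPg]
    exact pinnedChain_integrableOn_kubo hω hl hβ hγ hb hc hg hM hgM hg0 z
  have hwb : ∀ z, |w z| ≤ K * M * Real.exp (ϑ * H z) / c := by
    intro z
    rw [hw_apply]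
    simp_rw [hPg_apply]
    exact pinnedChain_abs_kubo_le hω hl hβ hγ hb hc hg hM hgM hg0 z
  -- the weight `e^{ϑH} ∈ L²(μ_T)`
  have hVc : Continuous fun z => Real.exp (ϑ * H z) :=
    Real.continuous_exp.comp (continuous_const.mul (pinnedChain_continuous_hamiltonian ω₂ lam β γ N))
  have hI2ϑ := pinnedChain_integrable_exp_mul_hamiltonian_gibbsMeasure hω hl hβ.le γ N hT h2ϑ
  have hIsq : Integrable (fun z => Real.exp (ϑ * H z) ^ 2) μ := by
    refine hI2ϑ.congr (Eventually.of_forall fun z => ?_)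
    change Real.exp (2 * ϑ * H z) = Real.exp (ϑ * H z) ^ 2
    rw [sq, ← Real.exp_add]; congr 1; ring
  have hexp2 : MemLp (fun z => Real.exp (ϑ * H z)) 2 μ :=
    (memLp_two_iff_integrable_sq hVc.aestronglyMeasurable).2 hIsq
  have hL2 : ∀ {f : PhaseSpace N → ℝ} (K' : ℝ), StronglyMeasurable f →
      (∀ z, |f z| ≤ K' * Real.exp (ϑ * H z)) → MemLp f 2 μ := fun K' hf hb' =>
    hexp2.of_le_mul (c := K') hf.aestronglyMeasurable (Eventually.of_forall fun z => by
      rw [Real.norm_eq_abs, Real.norm_eq_abs, abs_of_pos (Real.exp_pos _)]; exact hb' z)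
  set I : ℝ := ∫ z, Real.exp (ϑ * H z) ^ 2 ∂μ with hI
  have hgL2 : MemLp g 2 μ := hL2 M hg.stronglyMeasurable hgM
  have hwSM : StronglyMeasurable w := by rw [hw]; exact hSM.integral_prod_left
  have hwL2 : MemLp w 2 μ := hL2 (K * M / c) hwSM (fun z => by rw [div_mul_eq_mul_div]; exact hwb z)
  -- the tail of the corrector: `w - k_t = ∫_t^∞ Pg s ds`
  have htail : ∀ t : ℝ, 0 ≤ t → ∀ z,
      |k t z - w z| ≤ K * M / c * Real.exp (-c * t) * Real.exp (ϑ * H z) := by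
    intro t ht z
    have e1 : w z - k t z = ∫ s in Ioi t, Pg s z := by
      rw [hw_apply, hk_apply]
      have h := intervalIntegral.integral_Ioi_sub_Ioi (hkubo z).1 ht
      linarith
    have hmaj : IntegrableOn (fun s => K * M * Real.exp (ϑ * H z) * Real.exp (-c * s)) (Ioi t) :=
      (exp_neg_integrableOn_Ioi t hc).const_mul _
    have hbd : ∀ᵐ s ∂(volume.restrict (Ioi t)), ‖Pg s z‖ ≤ K * M * Real.exp (ϑ * H z) * Real.exp (-c * s) :=
      (ae_restrict_iff' measurableSet_Ioi).2 (Eventually.of_forall fun s hs => by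
        have hs' : t < s := hs
        rw [Real.norm_eq_abs]
        exact (hkubo z).2 s (ht.trans hs'.le))
    have h := norm_integral_le_of_norm_le hmaj hbd
    rw [integral_const_mul, integral_exp_mul_Ioi (neg_lt_zero.2 hc) t, Real.norm_eq_abs,
      neg_div_neg_eq] at h
    rw [abs_sub_comm, e1]
    calc |∫ s in Ioi t, Pg s z| ≤ K * M * Real.exp (ϑ * H z) * (Real.exp (-c * t) / c) := h
      _ = K * M / c * Real.exp (-c * t) * Real.exp (ϑ * H z) := by ring
  -- `k_t → w` and `P_t g → 0` in `L²(μ_T)`, quantitatively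
  have hkw : ∀ t : ℝ, 0 ≤ t → ∫ z, (k t z - w z) ^ 2 ∂μ ≤ (K * M / c * Real.exp (-c * t)) ^ 2 * I :=
    fun t ht => integral_sq_le_sq_mul_of_abs_le hIsq (fun z => htail t ht z)
  have hPg2 : ∀ t : ℝ, 0 ≤ t → ∫ z, (Pg t z) ^ 2 ∂μ ≤ (K * M * Real.exp (-c * t)) ^ 2 * I :=
    fun t ht => integral_sq_le_sq_mul_of_abs_le hIsq (fun z => by
      calc |Pg t z| ≤ K * M * Real.exp (ϑ * H z) * Real.exp (-c * t) := (hkubo z).2 t ht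
        _ = K * M * Real.exp (-c * t) * Real.exp (ϑ * H z) := by ring)
  have hexp0 : Tendsto (fun t : ℝ => Real.exp (-c * t)) atTop (𝓝 0) := by
    have h := Real.tendsto_exp_neg_atTop_nhds_zero.comp (tendsto_id.const_mul_atTop hc)
    refine h.congr fun t => ?_
    simp only [Function.comp_apply, id_eq, neg_mul]
  have hA0 : Tendsto (fun t : ℝ => (K * M / c * Real.exp (-c * t)) ^ 2 * I) atTop (𝓝 0) := by
    have h := ((hexp0.const_mul (K * M / c)).pow 2).mul_const I
    rw [mul_zero, zero_pow two_ne_zero, zero_mul] at h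
    exact h
  have hB0 : Tendsto (fun t : ℝ => (K * M * Real.exp (-c * t)) ^ 2 * I) atTop (𝓝 0) := by
    have h := ((hexp0.const_mul (K * M)).pow 2).mul_const I
    rw [mul_zero, zero_pow two_ne_zero, zero_mul] at h
    exact h
  have hsmall : ∀ δ : ℝ, 0 < δ → ∃ t : ℝ, 0 ≤ t ∧
      ∫ z, (k t z - w z) ^ 2 ∂μ ≤ δ ∧ ∫ z, (Pg t z) ^ 2 ∂μ ≤ δ := by
    intro δ hδ
    obtain ⟨t, ht0, h1, h2⟩ := ((eventually_ge_atTop (0 : ℝ)).and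
      ((hA0.eventually_le_const hδ).and (hB0.eventually_le_const hδ))).exists
    exact ⟨t, ht0, (hkw t ht0).trans h1, (hPg2 t ht0).trans h2⟩
  -- the diagonal sequence
  have hU1 : ContDiff ℝ 1 P.U := pinnedChain_contDiff_U ω₂ lam β γ
  have hV1 : ContDiff ℝ 1 P.V := pinnedChain_contDiff_V ω₂ lam β γ
  set δ : ℕ → ℝ := fun n => 1 / ((n : ℝ) + 1) with hδ
  have hδpos : ∀ n, 0 < δ n := fun n => by rw [hδ]; positivity
  have hstep : ∀ n : ℕ, ∃ F : PhaseSpace N → ℝ, ContDiff ℝ (⊤ : ℕ∞) F ∧ HasCompactSupport F ∧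
      ∫ z, (F z - w z) ^ 2 ∂μ ≤ 4 * δ n ∧
      ∫ z, (P.generator N T T F z - (-g z)) ^ 2 ∂μ ≤ 4 * δ n := by
    intro n
    obtain ⟨t, ht0, hkt, hPt⟩ := hsmall (δ n) (hδpos n)
    obtain ⟨Fs, hFs, hu, hv⟩ :=
      pinnedChain_window_core hω hl hβ hγ hN hT hϑ h2ϑ hM hg hgM Pg hPg k hk hN2 ht0
    obtain ⟨m, hm1, hm2⟩ :=
      ((hu.eventually_le_const (hδpos n)).and (hv.eventually_le_const (hδpos n))).exists
    obtain ⟨hkSM, hkL2⟩ := hkreg t ht0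
    have hFL2 : MemLp (Fs m) 2 μ := (hFs m).1.continuous.memLp_of_hasCompactSupport (hFs m).2
    have hLFL2 : MemLp (P.generator N T T (Fs m)) 2 μ :=
      (P.continuous_generator hU1 hV1 N T T ((hFs m).1.of_le (by norm_cast))).memLp_of_hasCompactSupport
        (P.hasCompactSupport_generator N T T ((hFs m).1.of_le (by norm_cast)) (hFs m).2)
    have hPgL2 : MemLp (Pg t) 2 μ := hL2 C (hSM.comp_measurable measurable_prodMk_left) (hPgb t)
    have hmidL2 : MemLp (fun z => Pg t z - g z) 2 μ := hPgL2.sub hgL2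
    have hngL2 : MemLp (fun z => -g z) 2 μ := hgL2.neg
    refine ⟨Fs m, (hFs m).1, (hFs m).2, ?_, ?_⟩
    · have h := integral_sub_sq_le_of_mid hFL2 hwL2 hkL2
      linarith
    · have h := integral_sub_sq_le_of_mid hLFL2 hngL2 hmidL2
      have e : ∫ z, (Pg t z - g z - -g z) ^ 2 ∂μ = ∫ z, (Pg t z) ^ 2 ∂μ :=
        integral_congr_ae (Eventually.of_forall fun z => by ring)
      rw [e] at h
      linarith
  choose Fs hFs hFsc hFw hFg using hstep
  have hδ0 : Tendsto (fun n => 4 * δ n) atTop (𝓝 0) := by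
    have h := (tendsto_one_div_add_atTop_nhds_zero_nat).const_mul (4 : ℝ)
    rw [mul_zero] at h
    exact h
  exact ⟨hgL2, hwL2, Fs, fun n => ⟨hFs n, hFsc n⟩,
    squeeze_zero (fun n => integral_nonneg fun z => sq_nonneg _) hFw hδ0,
    squeeze_zero (fun n => integral_nonneg fun z => sq_nonneg _) hFg hδ0⟩

end Core

/-- **The source–corrector pairing is `O(1)` uniformly in `N`** (crux `ExtensiveSnapshotIrreversibility`, line
`clausius-budget-sound-window`, registered sub-goal `contactPairingBound`). For the pinned anharmonic chain
`P = pinnedChain ω₂ lam β γ` (`ω₂, lam, β, γ > 0`) at `N ≥ 2` with both baths at `T > 0` (equilibrium kernels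
`P_t = P.transitionKernel N T T t`, Gibbs state `μ_T`), GIVEN (INV) Gibbs invariance and (MIX) exponential mixing
of the kernels (dictionary hypotheses of the line; both are tree theorems, and the proof uses the tree versions),
with `g = (γ/2T²)(p_0² - p_{N-1}²)`, `Pg s = P_{s⁺} g` and the McLennan corrector `w = ∫_{(0,∞)} Pg s ds`:
`0 ≤ ∫ g·w dμ_T ≤ γ/(2T²)` — the stationary form of the Clausius budget (formally `⟨g,w⟩ = -⟨Lw,w⟩ =
γT Σ_b ‖∂_{p_b} w‖²`, the contact Fisher information of the linear response). Proof: along the core sequence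
`F_n → w`, `LF_n → -g` of `pinnedChain_corrector_core`, the static contact calculus (`stub_gibbsContactCalculus`:
(a) `∫ F·LF = -γT Σ_b ‖∂_{p_b}F‖²`, (b) `∫ (p_b² - T) F = T ∫ p_b ∂_{p_b} F`; `∫ p_b² dμ_T = T`) gives `∫ F·LF ≤ 0`
and, by AM–GM with the weight `1/(2T²)` (the dissipation absorbs the source exactly), `∫ F·LF + 2∫ g F ≤ γ/(2T²)`;
both pass to the limit (`le_of_core_limit`): `-⟨g,w⟩ ≤ 0` and `-⟨g,w⟩ + 2⟨g,w⟩ ≤ γ/(2T²)`.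
[cite: CuneoEckmannHairerReyBellet2018, Thm 2.13 and §3.1] -/
theorem contactPairingBound :
    ∀ ω₂ lam β γ : ℝ, 0 < ω₂ → 0 < lam → 0 < β → 0 < γ → ∀ T : ℝ, 0 < T → ∀ (N : ℕ) (hN : 2 ≤ N),
      let P := pinnedChain ω₂ lam β γ
      let μT := P.gibbsMeasure N T
      (∀ t : ℝ≥0, μT.bind (P.transitionKernel N T T t) = μT) →
      (∀ ϑ : ℝ, 0 < ϑ → ϑ < 1 / T → ∃ C c : ℝ, 0 < C ∧ 0 < c ∧
        ∀ (z : PhaseSpace N) (t : ℝ≥0) (f : PhaseSpace N → ℝ), Continuous f →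
          (∀ y, |f y| ≤ Real.exp (ϑ * P.hamiltonian N y)) →
          |(∫ y, f y ∂(P.transitionKernel N T T t z)) - ∫ y, f y ∂μT| ≤
            C * Real.exp (ϑ * P.hamiltonian N z) * Real.exp (-c * t)) →
      let g : PhaseSpace N → ℝ := fun y =>
        γ / (2 * T ^ 2) * (y.2 ⟨0, by omega⟩ ^ 2 - y.2 ⟨N - 1, by omega⟩ ^ 2)
      let Pg : ℝ → PhaseSpace N → ℝ := fun s z => ∫ y, g y ∂(P.transitionKernel N T T s.toNNReal z)
      let w : PhaseSpace N → ℝ := fun z => ∫ s in Set.Ioi (0 : ℝ), Pg s z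
      0 ≤ ∫ z, g z * w z ∂μT ∧ ∫ z, g z * w z ∂μT ≤ γ / (2 * T ^ 2) := by
  intro ω₂ lam β γ hω hl hβ hγ T hT N hN P μT _ _ g Pg w
  have hN0 : 0 < N := by omega
  have hN1 : N - 1 < N := by omega
  -- freeze the `let`-bound observables (keep only their defining equations)
  have hg_def : g = fun y : PhaseSpace N =>
      γ / (2 * T ^ 2) * (y.2 ⟨0, hN0⟩ ^ 2 - y.2 ⟨N - 1, hN1⟩ ^ 2) := rfl
  have hPg_def : Pg = fun s z => ∫ y, g y ∂((pinnedChain ω₂ lam β γ).transitionKernel N T T s.toNNReal z) :=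
    rfl
  have hw_def : w = fun z => ∫ s in Set.Ioi (0 : ℝ), Pg s z := rfl
  clear_value w Pg g
  haveI : IsProbabilityMeasure μT := pinnedChain_isProbabilityMeasure_gibbsMeasure hω hl.le hβ.le γ N hT
  set b₀ : Fin N := ⟨0, hN0⟩ with hb₀
  set b₁ : Fin N := ⟨N - 1, hN1⟩ with hb₁
  set a : ℝ := γ / (2 * T ^ 2) with ha
  set H := P.hamiltonian N with hH
  have ha0 : 0 ≤ a := by rw [ha]; positivity
  -- the source is nice with `ϑ = 1/(4T)`, and centred
  set ϑ : ℝ := 1 / (4 * T) with hϑ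
  have hϑ0 : 0 < ϑ := by rw [hϑ]; positivity
  have h2ϑ : 2 * ϑ < 1 / T := by
    rw [hϑ, show 2 * (1 / (4 * T)) = 1 / (2 * T) by field_simp; ring]
    exact one_div_lt_one_div_of_lt hT (by linarith)
  have hg_apply : ∀ y : PhaseSpace N, g y = a * (y.2 b₀ ^ 2 - y.2 b₁ ^ 2) := fun y => by rw [hg_def]
  have hq : ∀ i : Fin N, Continuous fun y : PhaseSpace N => y.2 i := fun i =>
    (continuous_apply i).comp continuous_snd
  have hgc : Continuous g := by
    rw [hg_def]
    exact continuous_const.mul (((hq b₀).pow 2).sub ((hq b₁).pow 2))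
  set Mg : ℝ := a * (2 * (2 / ϑ + T)) with hMg
  have hMg0 : 0 ≤ Mg := by rw [hMg]; positivity
  have hgM : ∀ y, |g y| ≤ Mg * Real.exp (ϑ * H y) := by
    intro y
    have h0 := abs_sq_momentum_sub_le_exp hω hl.le (γ := γ) (N := N) hβ.le hϑ0 hT.le y b₀
    have h1 := abs_sq_momentum_sub_le_exp hω hl.le (γ := γ) (N := N) hβ.le hϑ0 hT.le y b₁
    rw [hg_apply, show a * (y.2 b₀ ^ 2 - y.2 b₁ ^ 2) = a * ((y.2 b₀ ^ 2 - T) - (y.2 b₁ ^ 2 - T)) by ring,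
      abs_mul, abs_of_nonneg ha0, hMg]
    calc a * |y.2 b₀ ^ 2 - T - (y.2 b₁ ^ 2 - T)| ≤ a * (|y.2 b₀ ^ 2 - T| + |y.2 b₁ ^ 2 - T|) :=
          mul_le_mul_of_nonneg_left (abs_sub _ _) ha0
      _ ≤ a * ((2 / ϑ + T) * Real.exp (ϑ * H y) + (2 / ϑ + T) * Real.exp (ϑ * H y)) := by gcongr
      _ = a * (2 * (2 / ϑ + T)) * Real.exp (ϑ * H y) := by ring
  have hmean : ∫ y, g y ∂μT = 0 := by
    rw [hg_def]; exact integral_sq_sub_sq_gibbsMeasure ω₂ lam β γ _ T _ _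
  -- the core sequence of the corrector
  obtain ⟨hgL2, hwL2, Fs, hFs, hu, hv⟩ :=
    pinnedChain_corrector_core hω hl.le hβ hγ hN0 hT hϑ0 h2ϑ hMg0 hgc hgM hmean Pg hPg_def w hw_def hN
  -- the static contact calculus on test functions
  have hDir : ∀ F : PhaseSpace N → ℝ, ContDiff ℝ (⊤ : ℕ∞) F → HasCompactSupport F →
      ∫ x, F x * P.generator N T T F x ∂μT =
        -(γ * T) * ∑ i : Fin N, ((if i.val = 0 then (1 : ℝ) else 0) + (if i.val = N - 1 then (1 : ℝ) else 0)) *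
          ∫ x, (partialP i F x) ^ 2 ∂μT :=
    fun F hF hFc => (stub_gibbsContactCalculus ω₂ lam β γ hω hl hβ hγ T hT N hN0 F hF hFc).1
  have hIBP : ∀ F : PhaseSpace N → ℝ, ContDiff ℝ (⊤ : ℕ∞) F → HasCompactSupport F → ∀ i : Fin N,
      ∫ x, (x.2 i ^ 2 - T) * F x ∂μT = T * ∫ x, x.2 i * partialP i F x ∂μT :=
    fun F hF hFc i => (stub_gibbsContactCalculus ω₂ lam β γ hω hl hβ hγ T hT N hN0 F hF hFc).2 i
  -- square integrability and second moment of the momenta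
  have hp2I : ∀ i : Fin N, Integrable (fun x : PhaseSpace N => x.2 i ^ 2) μT := fun i =>
    (pinnedChain ω₂ lam β γ).integrable_gibbsMeasure
      (pinnedChain_integrable_momentum_pow_mul_gibbsDensity hω hl.le hβ.le γ N hT i (by norm_num))
  have hp2 : ∀ i : Fin N, ∫ x, x.2 i ^ 2 ∂μT = T := fun i =>
    pinnedChain_integral_sq_momentum_gibbsMeasure hω hl.le hβ.le γ N hT i
  -- STEP 1: the two bounds on test functions
  have hstep : ∀ F : PhaseSpace N → ℝ, ContDiff ℝ (⊤ : ℕ∞) F → HasCompactSupport F →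
      ((∫ x, F x * P.generator N T T F x ∂μT) + ∫ x, (0 : ℝ) * F x ∂μT ≤ 0) ∧
      ((∫ x, F x * P.generator N T T F x ∂μT) + ∫ x, (2 * g x) * F x ∂μT ≤ γ / (2 * T ^ 2)) := by
    intro F hF hFc
    have hF2 : ContDiff ℝ 2 F := hF.of_le (by norm_cast)
    have hFd : Differentiable ℝ F := hF2.differentiable (by norm_num)
    have hFcont : Continuous F := hF.continuous
    set dF : Fin N → PhaseSpace N → ℝ := fun i x => partialP i F x with hdF
    have hdFc : ∀ i, Continuous (dF i) := fun i => continuous_partialP hF (by simp) i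
    have hdFs : ∀ i, HasCompactSupport (dF i) := fun i => hasCompactSupport_partialP hFd hFc i
    have hA2 : ∀ i, Integrable (fun x => (dF i x) ^ 2) μT := fun i =>
      ((hdFc i).memLp_of_hasCompactSupport (hdFs i)).integrable_sq
    set A : Fin N → ℝ := fun i => ∫ x, (dF i x) ^ 2 ∂μT with hA
    set J : Fin N → ℝ := fun i => ∫ x, x.2 i * dF i x ∂μT with hJ
    have hA0 : ∀ i, 0 ≤ A i := fun i => integral_nonneg fun x => sq_nonneg _
    -- (a): the Dirichlet form
    have ha' : ∫ x, F x * P.generator N T T F x ∂μT = -(γ * T) * (A b₀ + A b₁) := by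
      rw [hDir F hF hFc, sum_contactWeight_mul hN0]
    -- (b): the source through the Gaussian integration by parts
    have hIi : ∀ i : Fin N, Integrable (fun x => (x.2 i ^ 2 - T) * F x) μT := fun i =>
      ((((hq i).pow 2).sub continuous_const).mul hFcont).integrable_of_hasCompactSupport hFc.mul_left
    have hgF : ∫ x, g x * F x ∂μT = a * (T * J b₀ - T * J b₁) := by
      have e : (fun x => g x * F x) = fun x => a * ((x.2 b₀ ^ 2 - T) * F x - (x.2 b₁ ^ 2 - T) * F x) := by
        funext x; rw [hg_apply]; ring
      rw [e, integral_const_mul, integral_sub (hIi b₀) (hIi b₁), hIBP F hF hFc b₀, hIBP F hF hFc b₁]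
    have h2gF : ∫ x, (2 * g x) * F x ∂μT = 2 * (a * (T * J b₀ - T * J b₁)) := by
      rw [← hgF, ← integral_const_mul]
      exact integral_congr_ae (Eventually.of_forall fun x => by ring)
    have h0F : ∫ x, (0 : ℝ) * F x ∂μT = 0 := by simp
    -- AM–GM with the weight `ε = 1/(2T²)`: the dissipation absorbs the source exactly
    set ε : ℝ := 1 / (2 * T ^ 2) with hε
    have hε0 : 0 < ε := by rw [hε]; positivity
    have hJb : ∀ i, |J i| ≤ (ε * T + ε⁻¹ * A i) / 2 := by
      intro i
      have h := abs_integral_mul_le_weighted (hp2I i) (hA2 i) hε0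
      rw [hp2 i] at h
      exact h
    have hkey : ∀ i, 2 * (a * T) * |J i| ≤ γ / (4 * T ^ 2) + γ * T * A i := by
      intro i
      have h1 := mul_le_mul_of_nonneg_left (hJb i) (by positivity : 0 ≤ 2 * (a * T))
      have e1 : 2 * (a * T) * ((ε * T + ε⁻¹ * A i) / 2) = γ / (4 * T ^ 2) + γ * T * A i := by
        rw [ha, hε]
        field_simp
        ring
      linarith
    have hc0 : 2 * (a * (T * J b₀)) ≤ 2 * (a * T) * |J b₀| := by
      have h : a * (T * J b₀) ≤ a * T * |J b₀| := by
        rw [← mul_assoc]; exact mul_le_mul_of_nonneg_left (le_abs_self _) (by positivity)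
      linarith
    have hc1 : -(2 * (a * (T * J b₁))) ≤ 2 * (a * T) * |J b₁| := by
      have h : -(a * (T * J b₁)) ≤ a * T * |J b₁| := by
        rw [← mul_assoc, ← mul_neg]; exact mul_le_mul_of_nonneg_left (neg_le_abs _) (by positivity)
      linarith
    have hγT : 0 ≤ γ * T := by positivity
    refine ⟨?_, ?_⟩
    · rw [ha', h0F]
      nlinarith [hA0 b₀, hA0 b₁]
    · rw [ha', h2gF]
      have e2 : γ / (2 * T ^ 2) = γ / (4 * T ^ 2) + γ / (4 * T ^ 2) := by field_simp; ring
      nlinarith [hkey b₀, hkey b₁, hA0 b₀, hA0 b₁]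
  -- STEP 2: pass to the limit along the core sequence
  have hU1 : ContDiff ℝ 1 P.U := pinnedChain_contDiff_U ω₂ lam β γ
  have hV1 : ContDiff ℝ 1 P.V := pinnedChain_contDiff_V ω₂ lam β γ
  have hFL2 : ∀ n, MemLp (Fs n) 2 μT := fun n =>
    (hFs n).1.continuous.memLp_of_hasCompactSupport (hFs n).2
  have hLFL2 : ∀ n, MemLp (P.generator N T T (Fs n)) 2 μT := fun n =>
    (P.continuous_generator hU1 hV1 N T T ((hFs n).1.of_le (by norm_cast))).memLp_of_hasCompactSupport
      (P.hasCompactSupport_generator N T T ((hFs n).1.of_le (by norm_cast)) (hFs n).2)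
  have hlow : (∫ z, w z * -g z ∂μT) + ∫ z, (0 : ℝ) * w z ∂μT ≤ 0 :=
    le_of_core_limit (q := fun z => -g z) (g := fun _ => (0 : ℝ)) hwL2 hgL2.neg (memLp_const 0) hFL2
      hLFL2 hu hv (fun n => (hstep (Fs n) (hFs n).1 (hFs n).2).1)
  have hup : (∫ z, w z * -g z ∂μT) + ∫ z, (2 * g z) * w z ∂μT ≤ γ / (2 * T ^ 2) :=
    le_of_core_limit (q := fun z => -g z) (g := fun z => 2 * g z) hwL2 hgL2.neg (hgL2.const_mul 2) hFL2
      hLFL2 hu hv (fun n => (hstep (Fs n) (hFs n).1 (hFs n).2).2)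
  have e1 : ∫ z, w z * -g z ∂μT = -∫ z, g z * w z ∂μT := by
    rw [← integral_neg]
    exact integral_congr_ae (Eventually.of_forall fun z => by ring)
  have e2 : ∫ z, (2 * g z) * w z ∂μT = 2 * ∫ z, g z * w z ∂μT := by
    rw [← integral_const_mul]
    exact integral_congr_ae (Eventually.of_forall fun z => by ring)
  have e3 : ∫ z, (0 : ℝ) * w z ∂μT = 0 := by simp
  rw [e1, e3] at hlow
  rw [e1, e2] at hup
  constructor <;> linarith

end Summit.AtomisticToContinuum.FouriersLaw.Theorems.ExtensiveSnapshotIrreversibility.ClausiusBudget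

end
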